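import Summits.BirchSwinnertonDyer.BirchSwinnertonDyer.Theorems.ByReductionTypeAtTwoTorsionEulerCharReverse
import Summits.BirchSwinnertonDyer.BirchSwinnertonDyer.Theorems.ByReductionTypeAtTwoTorsionEulerCharExactOfReverse
import HarnessLib

set_option linter.dupNamespace false -- `…BirchSwinnertonDyer.BirchSwinnertonDyer…` is the cell's nested layout (D-0017)
set_option autoImplicit false

/-!
# Greenberg LNM 1716 Lemma 4.7 WITH RATIONAL `p`-TORSION — EXACTLY, modulo Lemma 4.6 on `Γ`-invariants (`h46`); and
# Theorem 4.1 over `ℚ` with rational `p`-torsion, TWO-SIDED, modulo `h46` ALONE (part 12 of the series)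

Cell `bsd-2adic` (run/shared/lean/pub/bsd-2adic/), seat `bsd-2adic-tower-1` GEN 33 (re-write of GEN 32's lost part H);
`--supports stmt-BirchSwinnertonDyer-19271` (helper). THEOREMS ONLY (no definition, no named fact, no `sorry`); closes no item;
nothing booked; no display re-keyed (D-0152); BSD is not proved by any of this.

R. Greenberg, *Iwasawa theory for elliptic curves*, LNM 1716 (1999), §4 Lemma 4.7 (pp. 107–108): `|ker g|·|E(F)_p| =
|ker r|·|(Sel_E(F_∞)_p)_Γ|`, and Thm. 4.1 (p. 102). In the tree's currency at an auxiliary good place `v₀ ∉ S`: part 3c (GEN 31,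
`prod_natCard_mul_natCard_endCoinvariants_le`) is the «`≥`» half `(∏_{v∈S} #𝒦_{v,0}[p^∞])·#(Sel_∞)_γ ≤ #(A₀/Sel₀)·#C`, part 9
(GEN 32, `natCard_kerG_mul_natCard_cokernel_le`) the «`≤`» half at Cassels' cokernel `C_{v₀}` MODULO the displayed hypothesis
`h46` (Lemma 4.6 read on the `Γ`-invariant vector supported above `v₀`), part 11 (`natCard_cokernel_eq`) Cassels' count
`#C_{v₀} = #E(K)(p)` WITH torsion. THIS FILE multiplies them out:

* **`natCard_kerG_mul_natCard_cokernel_eq`** — for every number field `K`, prime `p`, `W/K` elliptic, CYCLOTOMIC `κ` with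
  topological generator `γ`, `Sel_{p^∞}(E/K)` finite, «DIV», local surjectivity at every finite place, `S ⊇ {bad} ∪ {v ∣ p}` with
  the `𝒦_{v,0}[p^∞]` finite on `S`, `v₀ ∉ S`, `(Sel_∞)_γ` finite, and `h46`:
  **`#(A₀/Sel₀) · #C_{v₀} = (∏_{v∈S} #𝒦_{v,0}[p^∞]) · #(Sel_∞)_γ`** — Lemma 4.7 with torsion EXACTLY modulo `h46`
  (with `#C_{v₀} = #E(K)(p)` this is the printed `|ker g|·|E(F)_p| = |ker r|·|(Sel_∞)_Γ|`, `|ker r| = ∏ #𝒦`).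
* `reverse_of_lemma46_rat` — over `ℚ`: the displayed reverse inequality REV(W, p, κ, γ, S, v₀) of
  `…TorsionEulerCharExactOfReverse` FOLLOWS from `h46` (finiteness of `(Sel_∞)_γ` from Lemmas 4.2/4.3, of `C_{v₀}` from part 5).
* **`constantCoeff_mul_sq_eq_ordinary_rat_of_lemma46`** — GOOD ORDINARY `p`, ANY rational `p`-torsion:
  `f(0)·#E(ℚ)(p)² = u·#Sel_{p^∞}(E/ℚ)·∏_{v∈S} #𝒦_{v,0}[p^∞]`, `u ∈ ℤ_pˣ`, modulo `h46` ALONE;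
* **`constantCoeff_mul_sq_eq_nonsplit_rat_of_lemma46`** — the NON-SPLIT multiplicative twin.

The printed / `ℚ_p` / display currencies (`…_printed_of_lemma46`, `charValue_rankZero_of_lemma46`,
`twoAdicEulerCharRankZero_of_lemma46`, `greenberg_charValue_rankZero_of_lemma46`, non-split) follow in `…TorsionEulerCharFact`.

HONEST FRAMING: `h46` (Greenberg's Lemma 4.6 on `Γ`-invariants above `v₀`; XL in the tree: twists `A_s` + Prop. 4.13, or
Λ-adic Poitou–Tate over the layers) is NOT proved here; everything else is kernel-checked over tree theorems. Closes no item; no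
summit statement is proved; the Birch–Swinnerton-Dyer conjecture is NOT proved by any of this.

References: [GreenbergLNM1716] Thm. 4.1 (p. 102), §4 p. 104, Lemmas 4.6–4.7 (pp. 105–108), pp. 112–113, Prop. 4.13 (pp. 121–122).
-/

noncomputable section

open scoped Classical NumberField

open NumberField IsDedekindDomain Field

namespace Summit.BirchSwinnertonDyer.BirchSwinnertonDyer.Theorems.TorsionEulerChar

open Literature.NumberTheory.EllipticCurves Literature.NumberTheory.GaloisRepresentations
  WeierstrassCurve ZpExtension Literature.NumberTheory.EllipticCurves.IwasawaAlgebra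
  Literature.NumberTheory.EllipticCurves.IwasawaDual
  Literature.NumberTheory.EllipticCurves.GreenbergVatsal2000 Literature.NumberTheory.EllipticCurves.GreenbergSelmer
  Literature.NumberTheory.EllipticCurves.Rank1Residual Summit.BirchSwinnertonDyer.Rank1Residual.X2

/-! ## §1 Lemma 4.7 with torsion, EXACTLY modulo `h46` (every number field, every prime) -/

section General

variable {K : Type} [Field K] [NumberField K] (W : WeierstrassCurve K) [W.IsElliptic] (p : ℕ) [hp : Fact p.Prime]
  (κ : ZpExtension K p) {γ : absoluteGaloisGroup K}

/-- **Greenberg LNM 1716 Lemma 4.7 WITH RATIONAL `p`-TORSION — EXACTLY, modulo Lemma 4.6 on `Γ`-invariants.** For `W/K`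
elliptic over a number field, `κ` the CYCLOTOMIC `ℤ_p`-extension with topological generator `γ`, `Sel_{p^∞}(E/K)` finite, «DIV»
for `H¹(K_∞, E[p^∞])` (`hdiv`), Greenberg's local surjectivity at every finite place (`hsurj`), a finite `S` off which `E` is
good and `v ∤ p` with `𝒦_{v,0}[p^∞]` finite on `S`, an auxiliary `v₀ ∉ S`, `(Sel_{p^∞}(E/K_∞))_γ` finite, and `h46` (Lemma 4.6
read on the `Γ`-invariant vector supported above `v₀`): with `C_{v₀} = H¹(Γ_{K_{v₀}}, E)(p)/loc_{v₀}(U)` Cassels' cokernel,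
**`#(A₀/Sel₀) · #C_{v₀} = (∏_{v ∈ S} #𝒦_{v,0}[p^∞]) · #(Sel_∞)_γ`** (parts 3c `≥` and 9 `≤`; `C_{v₀}` is finite by part 5).
With part 11 (`#C_{v₀} = #E(K)(p)`) this is the printed `|ker g|·|E(F)_p| = |ker r|·|(Sel_E(F_∞)_p)_Γ|`.
[cite: GreenbergLNM1716, §4 Lemma 4.7 (pp. 107–108), Lemma 4.6 (p. 105), p. 104] -/
theorem natCard_kerG_mul_natCard_cokernel_eq (hκ : κ.IsCyclotomic) (hγ : κ.IsTopGenerator γ)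
    (hSel : Finite (W.selmerGroupPInfty p))
    (hdiv : ∀ s : W.subgroupH1 p κ.kerSubgroup,
      ∃ t : W.subgroupH1 p κ.kerSubgroup, W.conjH1 p κ.kerSubgroup γ t - t = s)
    (hsurj : ∀ (v : HeightOneSpectrum (𝓞 K))
      (c : discreteH1 (localSubgroup κ.kerSubgroup (v.adicCompletion K)) (localPoints W (v.adicCompletion K))),
      (∃ k : ℕ, p ^ k • c = 0) →
      (∀ δ : absoluteGaloisGroup (v.adicCompletion K),
        Literature.NumberTheory.EllipticCurves.conjH1 (localSubgroup κ.kerSubgroup (v.adicCompletion K))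
          (localPoints W (v.adicCompletion K)) δ c = c) →
      ∃ x : discreteH1 (localSubgroup (⊤ : Subgroup (absoluteGaloisGroup K)) (v.adicCompletion K))
          (localPoints W (v.adicCompletion K)),
        (∃ k : ℕ, p ^ k • x = 0) ∧
        Literature.NumberTheory.EllipticCurves.resOfLe (localPoints W (v.adicCompletion K))
          (Subgroup.comap_mono le_top :
            localSubgroup κ.kerSubgroup (v.adicCompletion K) ≤
              localSubgroup (⊤ : Subgroup (absoluteGaloisGroup K)) (v.adicCompletion K)) x = c)
    (S : Finset (HeightOneSpectrum (𝓞 K))) (hS : ∀ v ∉ S, ((p : ℕ) : 𝓞 K) ∉ v.asIdeal ∧ W.HasGoodReductionAt v)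
    (v₀ : HeightOneSpectrum (𝓞 K)) (hv₀ : v₀ ∉ S)
    (hT : ∀ v ∈ S, Finite (W.localTowerKerPrimary κ (v.adicCompletion K) 0))
    [Finite (EndCoinvariants (W.conjSelmerInfty κ γ - 1))]
    (h46 : ∀ z : discreteH1 (localSubgroup (⊤ : Subgroup (absoluteGaloisGroup K)) (v₀.adicCompletion K))
        (localPoints W (v₀.adicCompletion K)), (∃ k : ℕ, p ^ k • z = 0) →
      ∃ T : W.subgroupH1 p κ.kerSubgroup,
        (∀ v : HeightOneSpectrum (𝓞 K), v ≠ v₀ → ∀ σ : absoluteGaloisGroup K,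
          W.conjH1 p κ.kerSubgroup σ T ∈ W.localKerOver p κ.kerSubgroup (v.adicCompletion K)) ∧
        (∀ (w : InfinitePlace K) (σ : absoluteGaloisGroup K),
          W.conjH1 p κ.kerSubgroup σ T ∈ W.localKerOver p κ.kerSubgroup w.Completion) ∧
        ∀ σ : absoluteGaloisGroup K,
          W.localResOver p κ.kerSubgroup (v₀.adicCompletion K) (W.conjH1 p κ.kerSubgroup σ T) =
            Literature.NumberTheory.EllipticCurves.resOfLe (localPoints W (v₀.adicCompletion K))
              (Subgroup.comap_mono le_top :
                localSubgroup κ.kerSubgroup (v₀.adicCompletion K) ≤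
                  localSubgroup (⊤ : Subgroup (absoluteGaloisGroup K)) (v₀.adicCompletion K)) z) :
    Nat.card (W.KerG κ 0) *
        Nat.card (AddCommGroup.primaryComponent
            (discreteH1 (localSubgroup (⊤ : Subgroup (absoluteGaloisGroup K)) (v₀.adicCompletion K))
              (localPoints W (v₀.adicCompletion K))) p ⧸
          (AddSubgroup.map (W.localResOver p ⊤ (v₀.adicCompletion K))
            (unramifiedOutside (⊤ : Subgroup (absoluteGaloisGroup K)) (W.geomPrimaryTorsion p) p
                ((↑S : Set (HeightOneSpectrum (𝓞 K))) ∪ {v₀}) ⊓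
              (⨅ v ∈ S, W.localKerOver p ⊤ (v.adicCompletion K)) ⊓
              (⨅ w : InfinitePlace K, W.localKerOver p ⊤ w.Completion))).addSubgroupOf
            (AddCommGroup.primaryComponent
              (discreteH1 (localSubgroup (⊤ : Subgroup (absoluteGaloisGroup K)) (v₀.adicCompletion K))
                (localPoints W (v₀.adicCompletion K))) p)) =
      (∏ v ∈ S, Nat.card (W.localTowerKerPrimary κ (v.adicCompletion K) 0)) *
        Nat.card (EndCoinvariants (W.conjSelmerInfty κ γ - 1)) := by
  classical
  let Pv := discreteH1 (localSubgroup (⊤ : Subgroup (absoluteGaloisGroup K)) (v₀.adicCompletion K))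
    (localPoints W (v₀.adicCompletion K))
  let P₀ : AddSubgroup Pv := AddCommGroup.primaryComponent Pv p
  let L : AddSubgroup Pv := AddSubgroup.map (W.localResOver p ⊤ (v₀.adicCompletion K))
    (unramifiedOutside (⊤ : Subgroup (absoluteGaloisGroup K)) (W.geomPrimaryTorsion p) p
        ((↑S : Set (HeightOneSpectrum (𝓞 K))) ∪ {v₀}) ⊓
      (⨅ v ∈ S, W.localKerOver p ⊤ (v.adicCompletion K)) ⊓
      (⨅ w : InfinitePlace K, W.localKerOver p ⊤ w.Completion))
  obtain ⟨hfin, -⟩ := finite_and_natCard_cokernel_le W p S hS v₀ hv₀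
  haveI : Finite (P₀ ⧸ L.addSubgroupOf P₀) := hfin
  refine le_antisymm ?_ ?_
  · exact natCard_kerG_mul_natCard_cokernel_le W p κ hγ S hS v₀ hv₀ hT h46
  · exact prod_natCard_mul_natCard_endCoinvariants_le W p κ hκ hγ hSel hdiv hsurj S hS v₀ hv₀
      (QuotientAddGroup.mk' (L.addSubgroupOf P₀)) (fun z ↦ by
        rw [QuotientAddGroup.mk'_apply, QuotientAddGroup.eq_zero_iff, AddSubgroup.mem_addSubgroupOf]) hT

end General

/-! ## §2 Over `ℚ`: the reverse inequality from `h46`, and Theorem 4.1 two-sided modulo `h46` alone -/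

/-- **Over `ℚ` the displayed reverse inequality REV(W, p, κ, γ, S, v₀) of `…TorsionEulerCharExactOfReverse` follows from `h46`.**
For `W/ℚ` globally minimal and elliptic, any `ℤ_p`-extension `κ` with topological generator `γ`, a dual datum `D` with
`char X = (f)`, `Sel_{p^∞}(E/ℚ)` finite, `𝒦_{v,0}[p^∞]` finite above `p` (`hTp`), `S ⊇ {bad} ∪ {p}`, `v₀ ∉ S` and `h46`:
**`#(A₀/Sel₀) · #C_{v₀} ≤ (∏_{v∈S} #𝒦_{v,0}[p^∞]) · #(Sel_∞)_γ`** — part 9, with `(Sel_∞)_γ` finite by Lemmas 4.2/4.3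
(`SelmerDualData.constantCoeff_charGenerator_mul_natCard_of_finite_selmerGroup_rat`) and `C_{v₀}` finite by part 5.
[cite: GreenbergLNM1716, §4 Lemma 4.7 (pp. 107–108), Lemma 4.6 (p. 105)] -/
theorem reverse_of_lemma46_rat (p : ℕ) [hp : Fact p.Prime] (W : WeierstrassCurve ℚ)
    [W.IsGloballyMinimal] [W.IsElliptic] (κ : ZpExtension ℚ p)
    {γ : absoluteGaloisGroup ℚ} (hγ : κ.IsTopGenerator γ) (D : W.SelmerDualData κ γ) [Finite (W.selmerGroupPInfty p)]
    (hTp : ∀ v : HeightOneSpectrum (𝓞 ℚ), ((p : ℕ) : 𝓞 ℚ) ∈ v.asIdeal →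
      Finite (W.localTowerKerPrimary κ (v.adicCompletion ℚ) 0))
    (S : Finset (HeightOneSpectrum (𝓞 ℚ))) (hS : ∀ v ∉ S, ((p : ℕ) : 𝓞 ℚ) ∉ v.asIdeal ∧ W.HasGoodReductionAt v)
    (v₀ : HeightOneSpectrum (𝓞 ℚ)) (hv₀ : v₀ ∉ S)
    (h46 : ∀ z : discreteH1 (localSubgroup (⊤ : Subgroup (absoluteGaloisGroup ℚ)) (v₀.adicCompletion ℚ))
        (localPoints W (v₀.adicCompletion ℚ)), (∃ k : ℕ, p ^ k • z = 0) →
      ∃ T : W.subgroupH1 p κ.kerSubgroup,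
        (∀ v : HeightOneSpectrum (𝓞 ℚ), v ≠ v₀ → ∀ σ : absoluteGaloisGroup ℚ,
          W.conjH1 p κ.kerSubgroup σ T ∈ W.localKerOver p κ.kerSubgroup (v.adicCompletion ℚ)) ∧
        (∀ (w : InfinitePlace ℚ) (σ : absoluteGaloisGroup ℚ),
          W.conjH1 p κ.kerSubgroup σ T ∈ W.localKerOver p κ.kerSubgroup w.Completion) ∧
        ∀ σ : absoluteGaloisGroup ℚ,
          W.localResOver p κ.kerSubgroup (v₀.adicCompletion ℚ) (W.conjH1 p κ.kerSubgroup σ T) =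
            Literature.NumberTheory.EllipticCurves.resOfLe (localPoints W (v₀.adicCompletion ℚ))
              (Subgroup.comap_mono le_top :
                localSubgroup κ.kerSubgroup (v₀.adicCompletion ℚ) ≤
                  localSubgroup (⊤ : Subgroup (absoluteGaloisGroup ℚ)) (v₀.adicCompletion ℚ)) z)
    (f : IwasawaAlgebra p) (hf : Module.charIdeal (IwasawaAlgebra p) D.X = Ideal.span {f}) :
    Nat.card (W.KerG κ 0) *
        Nat.card (AddCommGroup.primaryComponent
            (discreteH1 (localSubgroup (⊤ : Subgroup (absoluteGaloisGroup ℚ)) (v₀.adicCompletion ℚ))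
              (localPoints W (v₀.adicCompletion ℚ))) p ⧸
          (AddSubgroup.map (W.localResOver p ⊤ (v₀.adicCompletion ℚ))
            (unramifiedOutside (⊤ : Subgroup (absoluteGaloisGroup ℚ)) (W.geomPrimaryTorsion p) p
                ((↑S : Set (HeightOneSpectrum (𝓞 ℚ))) ∪ {v₀}) ⊓
              (⨅ v ∈ S, W.localKerOver p ⊤ (v.adicCompletion ℚ)) ⊓
              (⨅ w : InfinitePlace ℚ, W.localKerOver p ⊤ w.Completion))).addSubgroupOf
            (AddCommGroup.primaryComponent
              (discreteH1 (localSubgroup (⊤ : Subgroup (absoluteGaloisGroup ℚ)) (v₀.adicCompletion ℚ))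
                (localPoints W (v₀.adicCompletion ℚ))) p)) ≤
      (∏ v ∈ S, Nat.card (W.localTowerKerPrimary κ (v.adicCompletion ℚ) 0)) *
        Nat.card (EndCoinvariants (W.conjSelmerInfty κ γ - 1)) := by
  classical
  let Pv := discreteH1 (localSubgroup (⊤ : Subgroup (absoluteGaloisGroup ℚ)) (v₀.adicCompletion ℚ))
    (localPoints W (v₀.adicCompletion ℚ))
  let P₀ : AddSubgroup Pv := AddCommGroup.primaryComponent Pv p
  let L : AddSubgroup Pv := AddSubgroup.map (W.localResOver p ⊤ (v₀.adicCompletion ℚ))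
    (unramifiedOutside (⊤ : Subgroup (absoluteGaloisGroup ℚ)) (W.geomPrimaryTorsion p) p
        ((↑S : Set (HeightOneSpectrum (𝓞 ℚ))) ∪ {v₀}) ⊓
      (⨅ v ∈ S, W.localKerOver p ⊤ (v.adicCompletion ℚ)) ⊓
      (⨅ w : InfinitePlace ℚ, W.localKerOver p ⊤ w.Completion))
  obtain ⟨hfin, -⟩ := finite_and_natCard_cokernel_le W p S hS v₀ hv₀
  haveI : Finite (P₀ ⧸ L.addSubgroupOf P₀) := hfin
  have hT : ∀ v ∈ S, Finite (W.localTowerKerPrimary κ (v.adicCompletion ℚ) 0) := fun v _ ↦ by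
    by_cases hpv : ((p : ℕ) : 𝓞 ℚ) ∈ v.asIdeal
    · exact hTp v hpv
    · exact W.finite_localTowerKerPrimary_zero_of_not_mem κ hpv
  have hg : Finite (W.KerG κ 0) := W.finite_kerG_zero_of_finite_localTowerKerPrimary_dvd κ hTp
  obtain ⟨-, -, -, hCofin, -⟩ := D.constantCoeff_charGenerator_mul_natCard_of_finite_selmerGroup_rat W hγ ‹_› hg f hf
  haveI := hCofin
  exact natCard_kerG_mul_natCard_cokernel_le W p κ hγ S hS v₀ hv₀ hT h46

/-- **Greenberg's Thm. 4.1 over `ℚ` at a GOOD ORDINARY `p`, ANY rational `p`-torsion, TWO-SIDED, modulo `h46` ALONE:**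
for `W/ℚ` globally minimal and elliptic with `GoodOrd W p`, `κ` cyclotomic with topological generator `γ`, `D` a dual datum with
`char X = (f)`, `Sel_{p^∞}(E/ℚ)` finite, `S ⊇ {bad} ∪ {p}` off which `E` is good and `v ∤ p`, `v₀ ∉ S`, and `h46` at `v₀`: `X` is
finitely generated `Λ`-torsion and **`f(0) · #E(ℚ)(p)² = u · #Sel_{p^∞}(E/ℚ) · ∏_{v ∈ S} #𝒦_{v,0}[p^∞]` with `u ∈ ℤ_pˣ`**
(`…_of_reverse` ∘ `reverse_of_lemma46_rat`; Lemma 3.4 at `n = 0` for the finiteness above `p`).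
[cite: GreenbergLNM1716, Thm. 4.1 (p. 102), §4 pp. 104–108] -/
theorem constantCoeff_mul_sq_eq_ordinary_rat_of_lemma46 (p : ℕ) [hp : Fact p.Prime] (W : WeierstrassCurve ℚ)
    [W.IsGloballyMinimal] [W.IsElliptic] (hgo : GoodOrd W p) (κ : ZpExtension ℚ p) (hκ : κ.IsCyclotomic)
    {γ : absoluteGaloisGroup ℚ} (hγ : κ.IsTopGenerator γ) (D : W.SelmerDualData κ γ) [Finite (W.selmerGroupPInfty p)]
    (S : Finset (HeightOneSpectrum (𝓞 ℚ))) (hS : ∀ v ∉ S, ((p : ℕ) : 𝓞 ℚ) ∉ v.asIdeal ∧ W.HasGoodReductionAt v)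
    (v₀ : HeightOneSpectrum (𝓞 ℚ)) (hv₀ : v₀ ∉ S)
    (h46 : ∀ z : discreteH1 (localSubgroup (⊤ : Subgroup (absoluteGaloisGroup ℚ)) (v₀.adicCompletion ℚ))
        (localPoints W (v₀.adicCompletion ℚ)), (∃ k : ℕ, p ^ k • z = 0) →
      ∃ T : W.subgroupH1 p κ.kerSubgroup,
        (∀ v : HeightOneSpectrum (𝓞 ℚ), v ≠ v₀ → ∀ σ : absoluteGaloisGroup ℚ,
          W.conjH1 p κ.kerSubgroup σ T ∈ W.localKerOver p κ.kerSubgroup (v.adicCompletion ℚ)) ∧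
        (∀ (w : InfinitePlace ℚ) (σ : absoluteGaloisGroup ℚ),
          W.conjH1 p κ.kerSubgroup σ T ∈ W.localKerOver p κ.kerSubgroup w.Completion) ∧
        ∀ σ : absoluteGaloisGroup ℚ,
          W.localResOver p κ.kerSubgroup (v₀.adicCompletion ℚ) (W.conjH1 p κ.kerSubgroup σ T) =
            Literature.NumberTheory.EllipticCurves.resOfLe (localPoints W (v₀.adicCompletion ℚ))
              (Subgroup.comap_mono le_top :
                localSubgroup κ.kerSubgroup (v₀.adicCompletion ℚ) ≤
                  localSubgroup (⊤ : Subgroup (absoluteGaloisGroup ℚ)) (v₀.adicCompletion ℚ)) z)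
    (f : IwasawaAlgebra p) (hf : Module.charIdeal (IwasawaAlgebra p) D.X = Ideal.span {f}) :
    Module.Finite (IwasawaAlgebra p) D.X ∧ Module.IsTorsion (IwasawaAlgebra p) D.X ∧
      ∃ u : ℤ_[p]ˣ, PowerSeries.constantCoeff f *
          (Nat.card (AddCommGroup.primaryComponent W.toAffine.Point p) : ℤ_[p]) ^ 2 =
        (u : ℤ_[p]) * Nat.card (W.selmerGroupPInfty p) *
          ∏ v ∈ S, Nat.card (W.localTowerKerPrimary κ (v.adicCompletion ℚ) 0) :=
  have hord : IsOrdinaryAt W p := hgo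
  constantCoeff_mul_sq_eq_ordinary_rat_of_reverse p W hgo κ hκ hγ D S hS v₀ hv₀
    (reverse_of_lemma46_rat p W κ hγ D (fun v hpv ↦ (InputsGreenbergLemma34.lemma34_rat_zero W p hord κ hκ v hpv).1)
      S hS v₀ hv₀ h46 f hf) f hf

/-- **The NON-SPLIT multiplicative twin, TWO-SIDED modulo `h46` ALONE:** for `W/ℚ` globally minimal and elliptic, non-split
multiplicative at `p`, `κ` cyclotomic with topological generator `γ`, `D` a dual datum with `char X = (f)`, `Sel_{p^∞}(E/ℚ)`
finite, `S ⊇ {bad} ∪ {p}`, `v₀ ∉ S`, and `h46` at `v₀`: `X` is finitely generated `Λ`-torsion and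
**`f(0) · #E(ℚ)(p)² = u · #Sel_{p^∞}(E/ℚ) · ∏_{v ∈ S} #𝒦_{v,0}[p^∞]`, `u ∈ ℤ_pˣ`** (finiteness above `p`: GEN 28
`MultTowerControl.exists_natCard_localTowerKerPrimary_le_multiplicative`). [cite: GreenbergLNM1716, §4 pp. 104–108 and 112–113] -/
theorem constantCoeff_mul_sq_eq_nonsplit_rat_of_lemma46 (p : ℕ) [hp : Fact p.Prime] (W : WeierstrassCurve ℚ)
    [W.IsGloballyMinimal] [W.IsElliptic] (hmult : W.HasMultiplicativeReductionAtPrime p)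
    (hns : ¬ W.HasSplitMultiplicativeReductionAtPrime p) (κ : ZpExtension ℚ p) (hκ : κ.IsCyclotomic)
    {γ : absoluteGaloisGroup ℚ} (hγ : κ.IsTopGenerator γ) (D : W.SelmerDualData κ γ) [Finite (W.selmerGroupPInfty p)]
    (S : Finset (HeightOneSpectrum (𝓞 ℚ))) (hS : ∀ v ∉ S, ((p : ℕ) : 𝓞 ℚ) ∉ v.asIdeal ∧ W.HasGoodReductionAt v)
    (v₀ : HeightOneSpectrum (𝓞 ℚ)) (hv₀ : v₀ ∉ S)
    (h46 : ∀ z : discreteH1 (localSubgroup (⊤ : Subgroup (absoluteGaloisGroup ℚ)) (v₀.adicCompletion ℚ))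
        (localPoints W (v₀.adicCompletion ℚ)), (∃ k : ℕ, p ^ k • z = 0) →
      ∃ T : W.subgroupH1 p κ.kerSubgroup,
        (∀ v : HeightOneSpectrum (𝓞 ℚ), v ≠ v₀ → ∀ σ : absoluteGaloisGroup ℚ,
          W.conjH1 p κ.kerSubgroup σ T ∈ W.localKerOver p κ.kerSubgroup (v.adicCompletion ℚ)) ∧
        (∀ (w : InfinitePlace ℚ) (σ : absoluteGaloisGroup ℚ),
          W.conjH1 p κ.kerSubgroup σ T ∈ W.localKerOver p κ.kerSubgroup w.Completion) ∧
        ∀ σ : absoluteGaloisGroup ℚ,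
          W.localResOver p κ.kerSubgroup (v₀.adicCompletion ℚ) (W.conjH1 p κ.kerSubgroup σ T) =
            Literature.NumberTheory.EllipticCurves.resOfLe (localPoints W (v₀.adicCompletion ℚ))
              (Subgroup.comap_mono le_top :
                localSubgroup κ.kerSubgroup (v₀.adicCompletion ℚ) ≤
                  localSubgroup (⊤ : Subgroup (absoluteGaloisGroup ℚ)) (v₀.adicCompletion ℚ)) z)
    (f : IwasawaAlgebra p) (hf : Module.charIdeal (IwasawaAlgebra p) D.X = Ideal.span {f}) :
    Module.Finite (IwasawaAlgebra p) D.X ∧ Module.IsTorsion (IwasawaAlgebra p) D.X ∧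
      ∃ u : ℤ_[p]ˣ, PowerSeries.constantCoeff f *
          (Nat.card (AddCommGroup.primaryComponent W.toAffine.Point p) : ℤ_[p]) ^ 2 =
        (u : ℤ_[p]) * Nat.card (W.selmerGroupPInfty p) *
          ∏ v ∈ S, Nat.card (W.localTowerKerPrimary κ (v.adicCompletion ℚ) 0) :=
  constantCoeff_mul_sq_eq_nonsplit_rat_of_reverse p W hmult hns κ hκ hγ D S hS v₀ hv₀
    (reverse_of_lemma46_rat p W κ hγ D (fun v hpv ↦ by
      obtain ⟨B, hB⟩ := MultTowerControl.exists_natCard_localTowerKerPrimary_le_multiplicative W hmult κ hκ v hpv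
      exact (hB 0).1) S hS v₀ hv₀ h46 f hf) f hf

end Summit.BirchSwinnertonDyer.BirchSwinnertonDyer.Theorems.TorsionEulerChar

end
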